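import Summits.SmoothPoincare4.SmoothPoincare4.Theses.EntropyRung
import HarnessLib

/-!
# Route EntropyRung — the LIFTED route (cut `ν(g₀) ≥ log Θ(S⁴)`) next to the filed one, kernel-checked

Companion to `EntropyRungCompactShrinkerGapThresholdLift.lean` (crux stmt-SmoothPoincare4-10870, line
`cgy-variance-pivot`, thirteenth lead). The route `Theses/EntropyRung.lean` proves
`SmoothPoincare4 ⇐ RUNG ∧ ENT` with the entropy cut at the cylinder, `ν_cyl = log 2 + ½ log π − 3/2`
(`= log Θ(S³×ℝ)`), and types RUNG over two density gaps (NoncompactShrinkerGap, stmt-10868;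
CompactShrinkerGap, stmt-10870). The cut is a free parameter: with `ν_rd := log Θ(S⁴) = log 6 − 2`
(`> ν_cyl`, margin `0.026`) define, in the route's own typing (Perelman's `𝒲` unfolded exactly as in
`SubcylindricalRecognition` / `SubcylindricalExistence`),

* RUNG♯: `R > 0` and `𝒲(g, f, τ) ≥ log 6 − 2` for all `τ > 0` and all normalised smooth `f`, on a closed
  `M ≃ₕ S⁴` ⇒ `M ≅ S⁴`;
* ENT♯: every closed `M ≃ₕ S⁴` carries such a metric (with Levi-Civita connection);
* NONCOMPACT♯: a complete non-compact non-flat normalised 4-d shrinker has `∫ e^{-f} dV < 96π² e^{-2}`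
  (`Θ < Θ(S⁴)`);
* COMPACT♯ (in the Threshold-Lift file): a compact one on `M ≃ₕ S⁴` with `∫ e^{-f} dV ≥ 96π² e^{-2}`
  lives on `S⁴`.

This file proves the bookkeeping of the lift:

* `helper_liftedAssembly : RUNG♯ → ENT♯ → SmoothPoincare4` (same proof as the route's `closes`);
* `helper_rungSharp_of_subcylindricalRecognition : SubcylindricalRecognition → RUNG♯` (RUNG♯ is WEAKER:
  its hypothesis `𝒲 ≥ ν_rd` gives `𝒲 ≥ ν_cyl + δ` with `δ = ν_rd − ν_cyl = log 3 − ½ log π − ½ > 0`,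
  i.e. `πe < 9`);
* `helper_subcylindricalExistence_of_entSharp : ENT♯ → SubcylindricalExistence` (ENT♯ is STRONGER, by the
  same `δ`; both are true on `S⁴` — the round metric has `ν = log 6 − 2` exactly — and both are
  equivalent to SPC4 given the corresponding rung, so nothing provable is lost);
* `helper_noncompactSharp_of_noncompactShrinkerGap : NoncompactShrinkerGap → NONCOMPACT♯` (WEAKER:
  `32π²√π e^{-3/2} < 96π² e^{-2}`);
* and `CompactShrinkerGap → COMPACT♯` is `helper_compactSharp_of_compactShrinkerGap` (Threshold-Lift file).

What is NOT kernel-checked (prose, for the planner): RUNG♯ follows from Bamler's singular-time package +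
NONCOMPACT♯ + (orbifold singularity models have `Θ ≤ 1/2`) + COMPACT♯ exactly as RUNG follows from the
filed gaps — Perelman monotonicity gives every singularity model `log Θ ≥ ν(g₀) ≥ ν_rd`, non-strictly,
which is all COMPACT♯ / NONCOMPACT♯ consume. The gain: COMPACT♯ needs no effective constant and follows
from Θ-maximality of the round sphere (ΘMAX♯) or from the volume comparison VOLCOMP♯ alone
(`helper_thresholdLiftReduction`), instead of `Vol ≤ 96π² ∧ R ≤ 10` / Weyl budget / Einstein rigidity at
margin `Θ − Θ_cyl`.

References: G. Perelman, arXiv:math/0211159 §§3–4 [Perelman2002Entropy]; H.-D. Cao, R. S. Hamilton,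
T. Ilmanen, arXiv:math/0404165 §4 [CaoHamiltonIlmanen2004]; R. Bamler, arXiv:2009.03243 §2
[Bamler2020Structure]; A. Hatcher, Algebraic Topology (2002), Prop. 3.29 [HatcherAT2002].
-/

-- the registered namespace `Summit.SmoothPoincare4.SmoothPoincare4.Theorems` repeats a component
set_option linter.dupNamespace false

noncomputable section

open MeasureTheory Set
open scoped Manifold ContDiff Topology ContinuousMap

namespace Summit.SmoothPoincare4.SmoothPoincare4.Theorems

open Summit.SmoothPoincare4.SmoothPoincare4.Theses.EntropyRung

/-! ## The two numerical margins -/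

/-- **The entropy margin of the round 4-sphere over the cylinder is positive**:
`ν_cyl = log 2 + ½ log π − 3/2 < log 6 − 2 = ν_rd` (`−0.2345 < −0.2083`), equivalently `πe < 9`.
[cite: CaoHamiltonIlmanen2004, §4] -/
theorem nuCyl_lt_nuRound : Real.log 2 + Real.log Real.pi / 2 - 3 / 2 < Real.log 6 - 2 := by
  have hpe : Real.pi * Real.exp 1 < 9 := by
    have h1 := Real.pi_lt_d4
    have h2 := Real.exp_one_lt_d9
    nlinarith [Real.pi_pos, Real.exp_pos (1 : ℝ)]
  have hlog : Real.log Real.pi + 1 < Real.log 9 := by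
    have h := Real.log_lt_log (by positivity) hpe
    rwa [Real.log_mul Real.pi_pos.ne' (Real.exp_pos 1).ne', Real.log_exp] at h
  have h6 : Real.log 6 = Real.log 2 + Real.log 3 := by
    rw [show (6 : ℝ) = 2 * 3 by norm_num, Real.log_mul (by norm_num) (by norm_num)]
  have h9 : Real.log 9 = 2 * Real.log 3 := by
    rw [show (9 : ℝ) = 3 ^ 2 by norm_num, Real.log_pow]
    norm_num
  rw [h6]
  rw [h9] at hlog
  linarith

/-- `32π²√π e^{-3/2} < 96π² e^{-2}` (`Θ(S³×ℝ) < Θ(S⁴)`, i.e. `√π e^{1/2} < 3`); private copy of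
`cylinderMass_lt_roundMass` of the Threshold-Lift rigidity file (not imported here).
[cite: CaoHamiltonIlmanen2004, §4] -/
private theorem cylinderMass_lt_roundMass_aux :
    32 * Real.pi ^ 2 * Real.sqrt Real.pi * Real.exp (-(3 : ℝ) / 2) <
      96 * Real.pi ^ 2 * Real.exp (-2) := by
  have hs : Real.sqrt Real.pi < 1.7725 := by
    rw [Real.sqrt_lt' (by norm_num)]
    have := Real.pi_lt_d4
    nlinarith
  have ht : Real.exp (1 / 2) < 1.6488 := by
    have h : Real.exp (1 / 2) ^ 2 < (1.6488 : ℝ) ^ 2 := by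
      rw [← Real.exp_nat_mul]
      norm_num
      have := Real.exp_one_lt_d9
      linarith
    exact lt_of_pow_lt_pow_left₀ 2 (by norm_num) h
  have hprod : Real.sqrt Real.pi * Real.exp (1 / 2) < 3 := by
    calc Real.sqrt Real.pi * Real.exp (1 / 2) < 1.7725 * 1.6488 :=
          mul_lt_mul'' hs ht (Real.sqrt_nonneg _) (Real.exp_pos _).le
      _ < 3 := by norm_num
  have hpi : 0 < 32 * Real.pi ^ 2 := by positivity
  have he : Real.exp (-(3 : ℝ) / 2) = Real.exp (1 / 2) * Real.exp (-2) := by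
    rw [← Real.exp_add]
    norm_num
  rw [he]
  have h2 : 0 < Real.exp (-2) := Real.exp_pos _
  nlinarith [mul_lt_mul_of_pos_right hprod (mul_pos hpi h2)]

/-! ## The lifted assembly and the comparisons with the filed items -/

/-- **Lifted assembly `RUNG♯ → ENT♯ → SmoothPoincare4` (registered helper `helper_liftedAssembly`).**
Verbatim the route's deciding theorem `EntropyRung.closes` with the cut `ν_cyl + δ` replaced by
`ν_rd = log 6 − 2`: for `M` with the summit binder and `e : M ≃ₕ S⁴`, compactness is Hatcher Prop. 3.29
(PROVED, `compactSpace_of_homotopyEquiv_sphere_four_holds`), `T₃` and the Borel σ-algebra are instances,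
ENT♯ supplies the metric and RUNG♯ recognises `S⁴`. [cite: HatcherAT2002, Prop. 3.29] -/
theorem helper_liftedAssembly :
    (∀ (M : Type) [TopologicalSpace M] [T2Space M] [SecondCountableTopology M]
      [ChartedSpace (EuclideanSpace ℝ (Fin 4)) M] [IsManifold (𝓡 4) ∞ M] [CompactSpace M]
      [T3Space M] [MeasurableSpace M] [BorelSpace M],
      M ≃ₕ Metric.sphere (0 : EuclideanSpace ℝ (Fin 5)) 1 →
    ∀ (g : Literature.Geometry.Lorentzian.PseudoRiemannianMetric (𝓡 4) ∞ (EuclideanSpace ℝ (Fin 4))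
        (TangentSpace (𝓡 4) : M → Type _)) [g.HasLeviCivita] (hg : g.IsRiemannian),
      (∀ x : M, 0 < g.scalarCurvature x) →
      (∀ τ : ℝ, 0 < τ → ∀ f : M → ℝ, ContMDiff (𝓡 4) 𝓘(ℝ, ℝ) ∞ f →
        ∫ x, (4 * Real.pi * τ) ^ (-(4 : ℝ) / 2) * Real.exp (-f x)
          ∂(Literature.Geometry.Lorentzian.riemannianMeasure (g.toContMDiffRiemannianMetric hg)) = 1 →
        Real.log 6 - 2 ≤
          ∫ x, (τ * (g.scalarCurvature x + g.gradSq f x) + f x - 4) *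
            ((4 * Real.pi * τ) ^ (-(4 : ℝ) / 2) * Real.exp (-f x))
            ∂(Literature.Geometry.Lorentzian.riemannianMeasure (g.toContMDiffRiemannianMetric hg))) →
      Nonempty (M ≃ₘ⟮𝓡 4, 𝓡 4⟯ Metric.sphere (0 : EuclideanSpace ℝ (Fin 5)) 1)) →
    (∀ (M : Type) [TopologicalSpace M] [T2Space M] [SecondCountableTopology M]
      [ChartedSpace (EuclideanSpace ℝ (Fin 4)) M] [IsManifold (𝓡 4) ∞ M] [CompactSpace M]
      [T3Space M] [MeasurableSpace M] [BorelSpace M],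
      M ≃ₕ Metric.sphere (0 : EuclideanSpace ℝ (Fin 5)) 1 →
      ∃ g : Literature.Geometry.Lorentzian.PseudoRiemannianMetric (𝓡 4) ∞ (EuclideanSpace ℝ (Fin 4))
        (TangentSpace (𝓡 4) : M → Type _), ∃ _ : g.HasLeviCivita, ∃ hg : g.IsRiemannian,
        (∀ x : M, 0 < g.scalarCurvature x) ∧
        ∀ τ : ℝ, 0 < τ → ∀ f : M → ℝ, ContMDiff (𝓡 4) 𝓘(ℝ, ℝ) ∞ f →
          ∫ x, (4 * Real.pi * τ) ^ (-(4 : ℝ) / 2) * Real.exp (-f x)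
            ∂(Literature.Geometry.Lorentzian.riemannianMeasure (g.toContMDiffRiemannianMetric hg)) = 1 →
          Real.log 6 - 2 ≤
            ∫ x, (τ * (g.scalarCurvature x + g.gradSq f x) + f x - 4) *
              ((4 * Real.pi * τ) ^ (-(4 : ℝ) / 2) * Real.exp (-f x))
              ∂(Literature.Geometry.Lorentzian.riemannianMeasure (g.toContMDiffRiemannianMetric hg))) →
    _root_.SmoothPoincare4 := by
  intro hRung hEnt M _ _ _ _ _ e
  haveI : CompactSpace M :=
    Literature.Topology.FourManifolds.compactSpace_of_homotopyEquiv_sphere_four_holds M e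
  letI : MeasurableSpace M := borel M
  haveI : BorelSpace M := ⟨rfl⟩
  obtain ⟨g, hLC, hg, hR, hν⟩ := hEnt M e
  exact hRung M e g hg hR hν

/-- **RUNG♯ is weaker than the filed RUNG (registered helper
`helper_rungSharp_of_subcylindricalRecognition`).** `SubcylindricalRecognition → RUNG♯`: a metric with
`𝒲(g,f,τ) ≥ log 6 − 2` for all admissible `(τ, f)` satisfies RUNG's hypothesis with
`δ := (log 6 − 2) − ν_cyl > 0` (`nuCyl_lt_nuRound`). [cite: CaoHamiltonIlmanen2004, §4] -/
theorem helper_rungSharp_of_subcylindricalRecognition :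
    Summit.SmoothPoincare4.SmoothPoincare4.Theses.EntropyRung.SubcylindricalRecognition →
    (∀ (M : Type) [TopologicalSpace M] [T2Space M] [SecondCountableTopology M]
      [ChartedSpace (EuclideanSpace ℝ (Fin 4)) M] [IsManifold (𝓡 4) ∞ M] [CompactSpace M]
      [T3Space M] [MeasurableSpace M] [BorelSpace M],
      M ≃ₕ Metric.sphere (0 : EuclideanSpace ℝ (Fin 5)) 1 →
    ∀ (g : Literature.Geometry.Lorentzian.PseudoRiemannianMetric (𝓡 4) ∞ (EuclideanSpace ℝ (Fin 4))
        (TangentSpace (𝓡 4) : M → Type _)) [g.HasLeviCivita] (hg : g.IsRiemannian),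
      (∀ x : M, 0 < g.scalarCurvature x) →
      (∀ τ : ℝ, 0 < τ → ∀ f : M → ℝ, ContMDiff (𝓡 4) 𝓘(ℝ, ℝ) ∞ f →
        ∫ x, (4 * Real.pi * τ) ^ (-(4 : ℝ) / 2) * Real.exp (-f x)
          ∂(Literature.Geometry.Lorentzian.riemannianMeasure (g.toContMDiffRiemannianMetric hg)) = 1 →
        Real.log 6 - 2 ≤
          ∫ x, (τ * (g.scalarCurvature x + g.gradSq f x) + f x - 4) *
            ((4 * Real.pi * τ) ^ (-(4 : ℝ) / 2) * Real.exp (-f x))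
            ∂(Literature.Geometry.Lorentzian.riemannianMeasure (g.toContMDiffRiemannianMetric hg))) →
      Nonempty (M ≃ₘ⟮𝓡 4, 𝓡 4⟯ Metric.sphere (0 : EuclideanSpace ℝ (Fin 5)) 1)) := by
  intro hRung M _ _ _ _ _ _ _ _ _ e g _ hg hR hW
  refine hRung M e g hg hR ⟨Real.log 6 - 2 - (Real.log 2 + Real.log Real.pi / 2 - 3 / 2), ?_, ?_⟩
  · linarith [nuCyl_lt_nuRound]
  · intro τ hτ f hf hnormal
    have h := hW τ hτ f hf hnormal
    linarith

/-- **ENT♯ implies the filed ENT (registered helper `helper_subcylindricalExistence_of_entSharp`).**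
`ENT♯ → SubcylindricalExistence`, with the same `δ = ν_rd − ν_cyl > 0`. (ENT♯ is the stronger
existence statement; on `S⁴` it holds by the round metric, `ν = log 6 − 2`; on an exotic `Σ` both are
equivalent to SPC4 given the corresponding rung.) [cite: CaoHamiltonIlmanen2004, §4] -/
theorem helper_subcylindricalExistence_of_entSharp :
    (∀ (M : Type) [TopologicalSpace M] [T2Space M] [SecondCountableTopology M]
      [ChartedSpace (EuclideanSpace ℝ (Fin 4)) M] [IsManifold (𝓡 4) ∞ M] [CompactSpace M]
      [T3Space M] [MeasurableSpace M] [BorelSpace M],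
      M ≃ₕ Metric.sphere (0 : EuclideanSpace ℝ (Fin 5)) 1 →
      ∃ g : Literature.Geometry.Lorentzian.PseudoRiemannianMetric (𝓡 4) ∞ (EuclideanSpace ℝ (Fin 4))
        (TangentSpace (𝓡 4) : M → Type _), ∃ _ : g.HasLeviCivita, ∃ hg : g.IsRiemannian,
        (∀ x : M, 0 < g.scalarCurvature x) ∧
        ∀ τ : ℝ, 0 < τ → ∀ f : M → ℝ, ContMDiff (𝓡 4) 𝓘(ℝ, ℝ) ∞ f →
          ∫ x, (4 * Real.pi * τ) ^ (-(4 : ℝ) / 2) * Real.exp (-f x)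
            ∂(Literature.Geometry.Lorentzian.riemannianMeasure (g.toContMDiffRiemannianMetric hg)) = 1 →
          Real.log 6 - 2 ≤
            ∫ x, (τ * (g.scalarCurvature x + g.gradSq f x) + f x - 4) *
              ((4 * Real.pi * τ) ^ (-(4 : ℝ) / 2) * Real.exp (-f x))
              ∂(Literature.Geometry.Lorentzian.riemannianMeasure (g.toContMDiffRiemannianMetric hg))) →
    Summit.SmoothPoincare4.SmoothPoincare4.Theses.EntropyRung.SubcylindricalExistence := by
  intro hEnt
  unfold SubcylindricalExistence
  intro M _ _ _ _ _ _ _ _ _ e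
  obtain ⟨g, hLC, hg, hR, hW⟩ := hEnt M e
  refine ⟨g, hLC, hg, hR, Real.log 6 - 2 - (Real.log 2 + Real.log Real.pi / 2 - 3 / 2), ?_, ?_⟩
  · linarith [nuCyl_lt_nuRound]
  · intro τ hτ f hf hnormal
    have h := hW τ hτ f hf hnormal
    linarith

/-- **NONCOMPACT♯ is weaker than the filed NoncompactShrinkerGap (registered helper
`helper_noncompactSharp_of_noncompactShrinkerGap`).** `NoncompactShrinkerGap → NONCOMPACT♯`:
`∫⁻ e^{-f} ≤ ofReal (32π²√π e^{-3/2}) < ofReal (96π² e^{-2})`. [cite: CaoHamiltonIlmanen2004, §4] -/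
theorem helper_noncompactSharp_of_noncompactShrinkerGap :
    Summit.SmoothPoincare4.SmoothPoincare4.Theses.EntropyRung.NoncompactShrinkerGap →
    (∀ (M : Type) [TopologicalSpace M] [T2Space M] [SecondCountableTopology M]
      [ChartedSpace (EuclideanSpace ℝ (Fin 4)) M] [IsManifold (𝓡 4) ∞ M] [ConnectedSpace M]
      [NoncompactSpace M] [T3Space M] [MeasurableSpace M] [BorelSpace M]
      (g : Literature.Geometry.Lorentzian.PseudoRiemannianMetric (𝓡 4) ∞ (EuclideanSpace ℝ (Fin 4))
        (TangentSpace (𝓡 4) : M → Type _)) [g.HasLeviCivita] (f : M → ℝ) (hg : g.IsRiemannian),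
      (∀ (x : M) (r : NNReal), IsCompact {y : M | g.edist hg x y ≤ r}) →
      ContMDiff (𝓡 4) 𝓘(ℝ, ℝ) ∞ f →
      (∀ (x : M) (X Y : TangentSpace (𝓡 4) x),
        g.ricci x X Y + g.hessian f x X Y = (1 / 2 : ℝ) * g.val x X Y) →
      (∀ x : M, g.scalarCurvature x + g.gradSq f x = f x) →
      (∃ x : M, g.scalarCurvature x ≠ 0) →
      ∫⁻ x, ENNReal.ofReal (Real.exp (-f x))
          ∂(Literature.Geometry.Lorentzian.riemannianMeasure (g.toContMDiffRiemannianMetric hg)) <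
        ENNReal.ofReal (96 * Real.pi ^ 2 * Real.exp (-2))) := by
  intro hNC M _ _ _ _ _ _ _ _ _ _ g _ f hg hproper hf hsol hnorm hR
  refine lt_of_le_of_lt (hNC M g f hg hproper hf hsol hnorm hR) ?_
  rw [ENNReal.ofReal_lt_ofReal_iff']
  exact ⟨cylinderMass_lt_roundMass_aux, by positivity⟩

end Summit.SmoothPoincare4.SmoothPoincare4.Theorems

end
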